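import Summits.KontsevichZagierPeriods.KontsevichZagierPeriods.Theorems.RootDecompWalshStrataEulerDescent01

/-!
# Conic descent, gen 6 (L4 one-variable Euler descent `[T, R(x)·√(ex²+fx+g)^{±1}] ∈ InBaker`), part 2/12

Declarations `InBaker.restrict_pos` … `InBaker.odd_factor` of the farm-checked gen-6 monolith; see the module docstring of
`EulerDescent01` (part 1) for the overview, the design and the sources. [KontsevichZagier2001 §1.1–1.2; BCR1998 §2.2; Euler 1768; this node gen 4 `sqrtDescent_*`]
-/

noncomputable section

open Literature.NumberTheory.Transcendental
open MeasureTheory Set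
open MvPolynomial (aeval)
open Literature.ModelTheory.ExponentialFields (IsSemialgebraic isSemialgebraic_univ
  isSemialgebraic_setOf_eval_pos isSemialgebraic_setOf_eval_lt isSemialgebraic_setOf_eval_le
  isSemialgebraic_setOf_eval_nonneg isSemialgebraic_setOf_eval_eq_zero continuous_aeval_real
  tarski_seidenberg_real_holds)

namespace Summit.KontsevichZagierPeriods.RootDecompWalshStrata.ConicDescent

/-- The derivative of `s ↦ s²` at `t` is `2t` (part-local `private` copy). [folklore] -/
private theorem hasDerivAt_sq' (t : ℝ) : HasDerivAt (fun s : ℝ => s ^ 2) (2 * t) t := by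
  simpa using hasDerivAt_pow 2 t

/-- The half-line `{t > 0}` is `ℚ`-semialgebraic (part-local `private` copy). [BCR1998 §2.2] -/
private theorem isSemialgebraic_pos' : IsSemialgebraic ℚ {v : Fin 1 → ℝ | 0 < v 0} := by
  convert isSemialgebraic_setOf_eval_pos (k := ℚ) (R := ℝ)
    (MvPolynomial.X (0 : Fin 1) : MvPolynomial (Fin 1) ℚ) using 1
  ext v
  simp

/-- To descend an integrand `F·√D` one may assume the domain lies in `{D > 0}`: outside it the
integrand vanishes (rule (1a) + null integrand), callback form. [this node] -/
theorem InBaker.restrict_pos (e f g : ℚ) (r : KZ.IntegralRep 1) (F : (Fin 1 → ℝ) → ℝ)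
    (hr : EqOn r.integrand (fun v => F v * √(qD e f g (v 0))) r.domain)
    (h : ∀ r₁ : KZ.IntegralRep 1, r₁.domain ⊆ r.domain → (∀ v ∈ r₁.domain, 0 < qD e f g (v 0)) →
      EqOn r₁.integrand (fun v => F v * √(qD e f g (v 0))) r₁.domain → InBaker (KZ.of r₁)) :
    InBaker (KZ.of r) := by
  have hA : IsSemialgebraic ℚ {v | v ∈ r.domain ∧ 0 < qD e f g (v 0)} :=
    IsSemialgebraicFunOn.isSemialgebraic_sep_pos
      (isSemialgebraicFunOn_qD e f g r.isSemialgebraic_domain)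
  refine InBaker.of_restrict_of_eqOn_zero r hA (fun v hv => hv.1) (fun v hv hvA => ?_) ?_
  · have hD : qD e f g (v 0) ≤ 0 := not_lt.1 fun h' => hvA ⟨hv, h'⟩
    rw [hr hv]
    change F v * √(qD e f g (v 0)) = 0
    rw [Real.sqrt_eq_zero'.2 hD, mul_zero]
  · exact h _ (fun v hv => hv.1) (fun v hv => hv.2) fun v hv => hr hv.1

/-! #### 24.2 Linear radicand, ANY rational factor: the chart `x = (t² − g)/f` is `ℚ`-rational -/

/-- **`R(x)·√(f x + g)`, `f ≠ 0`, `R = P/Q ∈ ℚ(x)` arbitrary** (`Q ≠ 0` on the domain): the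
substitution `x = (t² − g)/f`, `t > 0`, is `ℚ`-rational and pulls the integrand back to
`R((t² − g)/f)·2t²/|f| ∈ ℚ(t)` on `{t > 0, Q((t² − g)/f) ≠ 0}`. [this node; Euler 1768] -/
theorem InBaker.linear_factor (f g : ℚ) (hf : f ≠ 0) (P Q : Polynomial ℚ) (r : KZ.IntegralRep 1)
    (hQ : ∀ v ∈ r.domain, Polynomial.aeval (v 0) Q ≠ 0)
    (hr : EqOn r.integrand (fun v => Polynomial.aeval (v 0) P / Polynomial.aeval (v 0) Q *
      √(qD 0 f g (v 0))) r.domain) :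
    InBaker (KZ.of r) := by
  refine InBaker.restrict_pos 0 f g r _ hr fun r₁ hsub hpos hr₁ => ?_
  have hf0 : (f : ℝ) ≠ 0 := by exact_mod_cast hf
  obtain ⟨φ, hφdef⟩ : ∃ φ : (Fin 1 → ℝ) → ℝ, φ = fun v => (v 0 ^ 2 - (g : ℝ)) / (f : ℝ) :=
    ⟨_, rfl⟩
  have hφ : IsRatOn {v : Fin 1 → ℝ | 0 < v 0} φ := by
    rw [hφdef]
    exact ((IsRatOn.coord.pow 2).sub (IsRatOn.const g)).div (IsRatOn.const f) fun _ _ => hf0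
  obtain ⟨T₀, hT₀def⟩ : ∃ T₀ : Set (Fin 1 → ℝ),
      T₀ = {v | v ∈ {v : Fin 1 → ℝ | 0 < v 0} ∧ Polynomial.aeval (φ v) Q ≠ 0} := ⟨_, rfl⟩
  have hT₀ : IsSemialgebraic ℚ T₀ := by
    rw [hT₀def]; exact (hφ.polyAeval Q).isSemialgebraic_sep_ne_zero isSemialgebraic_pos'
  have hT₀sub : T₀ ⊆ {v : Fin 1 → ℝ | 0 < v 0} := fun v hv => by rw [hT₀def] at hv; exact hv.1
  have hT₀Q : ∀ v ∈ T₀, Polynomial.aeval (φ v) Q ≠ 0 := fun v hv => by rw [hT₀def] at hv; exact hv.2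
  have hφ₀ : IsRatOn T₀ φ := hφ.mono hT₀sub
  have hφv : ∀ v : Fin 1 → ℝ, φ v = (v 0 ^ 2 - (g : ℝ)) / (f : ℝ) := fun v => by rw [hφdef]
  refine InBaker.of_cov₁_rat r₁ hT₀ (fun t => (t ^ 2 - g) / f) (fun t => 2 * t / f) ?_ ?_ ?_ ?_
    (fun v => Polynomial.aeval (φ v) P / Polynomial.aeval (φ v) Q * (2 * v 0 ^ 2 / |(f : ℝ)|)) ?_
    fun v hv hvd => ?_
  · exact (hφ₀.isSemialgebraicFunOn hT₀).congr fun v _ => hφv v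
  · intro v _
    exact ((hasDerivAt_sq' (v 0)).sub_const (g : ℝ)).div_const (f : ℝ)
  · intro s hs t ht h
    have hs0 : 0 < s 0 := hT₀sub hs
    have ht0 : 0 < t 0 := hT₀sub ht
    have h2 : s 0 ^ 2 = t 0 ^ 2 := by
      have := (div_left_inj' hf0).1 h
      linarith
    exact (pow_left_inj₀ hs0.le ht0.le two_ne_zero).1 h2
  · intro x hx
    have hD : 0 < (f : ℝ) * x 0 + g := by have := hpos x hx; simpa [qD] using this
    have hx' : ((√((f : ℝ) * x 0 + g)) ^ 2 - g) / f = x 0 := by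
      rw [Real.sq_sqrt hD.le]; field_simp; ring
    refine ⟨fun _ => √((f : ℝ) * x 0 + g), ?_, hx'⟩
    rw [hT₀def]
    refine ⟨Real.sqrt_pos.2 hD, ?_⟩
    rw [hφv]
    rw [hx']
    exact hQ x (hsub hx)
  · have habs : IsRatOn T₀ fun v => 2 * v 0 ^ 2 / |(f : ℝ)| :=
      (((IsRatOn.const 2).mul (IsRatOn.coord.pow 2)).div (IsRatOn.const |f|) fun _ _ => by
        rw [Rat.cast_abs]; exact abs_ne_zero.2 hf0).congr fun v _ => by
          rw [Rat.cast_abs]; norm_num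
    exact ((hφ₀.polyAeval P).div (hφ₀.polyAeval Q) hT₀Q).mul habs
  · have hv0 : 0 < v 0 := hT₀sub hv
    have hin : (f : ℝ) * ((v 0 ^ 2 - g) / f) + g = v 0 ^ 2 := by field_simp; ring
    rw [hr₁ hvd]
    simp only [lift₁_apply, qD, Rat.cast_zero, zero_mul, zero_add, hφv]
    rw [hin, Real.sqrt_sq hv0.le, abs_div, abs_of_pos (by positivity : (0 : ℝ) < 2 * v 0)]
    field_simp

/-! #### 24.3 Odd factors: the composite chart `x = x₀ ± √((t² − h)/e)`, `t = √Δ` -/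

/-- Right half (`x > x₀`) of the ODD-FACTOR descent: for `e ≠ 0` and the integrand
`(x − x₀)·S((x − x₀)²)·√(e x² + f x + g)` (`S = P/Q ∈ ℚ(s)`, `x₀ = −f/(2e)`, `h = g − f²/(4e)`)
on a domain inside `{x > x₀, Δ > 0}`, the chart `x = x₀ + √ψ(t)`, `ψ(t) = (t² − h)/e`, `t = √Δ > 0`,
is `ℚ`-semialgebraic, and since `(x − x₀)·dx = ψ′(t)dt/2 = t dt/e` it pulls the integrand back to the
RATIONAL `S(ψ(t))·t²/|e|`. [this node] -/
theorem InBaker.odd_right (e f g : ℚ) (he : e ≠ 0) (P Q : Polynomial ℚ) (r : KZ.IntegralRep 1)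
    (hdom : ∀ v ∈ r.domain, (((-f / (2 * e) : ℚ) : ℝ)) < v 0 ∧ 0 < qD e f g (v 0))
    (hQ : ∀ v ∈ r.domain, Polynomial.aeval ((v 0 - ((-f / (2 * e) : ℚ) : ℝ)) ^ 2) Q ≠ 0)
    (hr : EqOn r.integrand (fun v => (v 0 - ((-f / (2 * e) : ℚ) : ℝ)) *
      (Polynomial.aeval ((v 0 - ((-f / (2 * e) : ℚ) : ℝ)) ^ 2) P /
        Polynomial.aeval ((v 0 - ((-f / (2 * e) : ℚ) : ℝ)) ^ 2) Q) * √(qD e f g (v 0))) r.domain) :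
    InBaker (KZ.of r) := by
  have he0 : (e : ℝ) ≠ 0 := by exact_mod_cast he
  set H : ℝ := ((g - f ^ 2 / (4 * e) : ℚ) : ℝ) with hHdef
  set X₀ : ℝ := ((-f / (2 * e) : ℚ) : ℝ) with hX₀def
  -- `ψ(t) = (t² − h)/e`
  obtain ⟨ψ, hψdef⟩ : ∃ ψ : (Fin 1 → ℝ) → ℝ, ψ = fun v => (v 0 ^ 2 - H) / e := ⟨_, rfl⟩
  have hψv : ∀ v : Fin 1 → ℝ, ψ v = (v 0 ^ 2 - H) / e := fun v => by rw [hψdef]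
  have hψ : IsRatOn (univ : Set (Fin 1 → ℝ)) ψ := by
    rw [hψdef]
    exact ((IsRatOn.coord.pow 2).sub (IsRatOn.const (g - f ^ 2 / (4 * e)))).div (IsRatOn.const e)
      fun _ _ => he0
  obtain ⟨S₀, hS₀def⟩ : ∃ S₀ : Set (Fin 1 → ℝ), S₀ = {v | 0 < v 0 ∧ 0 < ψ v} := ⟨_, rfl⟩
  have hS₀ : IsSemialgebraic ℚ S₀ := by
    have hpoly : ∀ v : Fin 1 → ℝ, aeval v ((MvPolynomial.X (0 : Fin 1) ^ 2 -
        MvPolynomial.C (g - f ^ 2 / (4 * e))) * MvPolynomial.C e⁻¹ : MvPolynomial (Fin 1) ℚ) =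
        ψ v := fun v => by
      rw [hψv, hHdef]
      simp only [map_mul, map_sub, map_pow, MvPolynomial.aeval_X, MvPolynomial.aeval_C, eq_ratCast,
        Rat.cast_inv, div_eq_mul_inv]
      push_cast
      ring
    rw [hS₀def]
    convert isSemialgebraic_pos'.inter (isSemialgebraic_setOf_eval_pos (k := ℚ) (R := ℝ)
      ((MvPolynomial.X (0 : Fin 1) ^ 2 - MvPolynomial.C (g - f ^ 2 / (4 * e))) *
        MvPolynomial.C e⁻¹ : MvPolynomial (Fin 1) ℚ)) using 1
    ext v
    simp only [mem_setOf_eq, mem_inter_iff, hpoly]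
  obtain ⟨T₀, hT₀def⟩ : ∃ T₀ : Set (Fin 1 → ℝ),
      T₀ = {v | v ∈ S₀ ∧ Polynomial.aeval (ψ v) Q ≠ 0} := ⟨_, rfl⟩
  have hT₀ : IsSemialgebraic ℚ T₀ := by
    rw [hT₀def]; exact ((hψ.mono (subset_univ _)).polyAeval Q).isSemialgebraic_sep_ne_zero hS₀
  have hT₀pos : ∀ v ∈ T₀, 0 < v 0 := fun v hv => by
    rw [hT₀def, hS₀def] at hv; exact hv.1.1
  have hT₀ψ : ∀ v ∈ T₀, 0 < ψ v := fun v hv => by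
    rw [hT₀def, hS₀def] at hv; exact hv.1.2
  have hT₀Q : ∀ v ∈ T₀, Polynomial.aeval (ψ v) Q ≠ 0 := fun v hv => by
    rw [hT₀def] at hv; exact hv.2
  have hψ₀ : IsRatOn T₀ ψ := hψ.mono (subset_univ _)
  -- the chart `x = X₀ + √ψ(t)` and its derivative `t/(e·√ψ(t))`
  refine InBaker.of_cov₁_rat r hT₀ (fun t => X₀ + √((t ^ 2 - H) / e))
    (fun t => (2 * t / e) / (2 * √((t ^ 2 - H) / e))) ?_ ?_ ?_ ?_
    (fun v => Polynomial.aeval (ψ v) P / Polynomial.aeval (ψ v) Q * (v 0 ^ 2 / |(e : ℝ)|)) ?_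
    fun v hv hvd => ?_
  · exact ((isSemialgebraicFunOn_ratCast hT₀ (-f / (2 * e))).add_holds
      (IsSemialgebraicFunOn.sqrt_holds (hψ₀.isSemialgebraicFunOn hT₀))).congr fun v _ => by
        simp only [Pi.add_apply, hX₀def, hψv]
  · intro v hv
    have hψpos : 0 < (v 0 ^ 2 - H) / e := by rw [← hψv]; exact hT₀ψ v hv
    have h1 : HasDerivAt (fun t : ℝ => (t ^ 2 - H) / e) (2 * v 0 / e) (v 0) :=
      ((hasDerivAt_sq' (v 0)).sub_const H).div_const (e : ℝ)
    exact (h1.sqrt hψpos.ne').const_add X₀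
  · intro s hs t ht hst
    have hs0 := hT₀pos s hs
    have ht0 := hT₀pos t ht
    have hs1 : 0 < (s 0 ^ 2 - H) / e := by rw [← hψv]; exact hT₀ψ s hs
    have ht1 : 0 < (t 0 ^ 2 - H) / e := by rw [← hψv]; exact hT₀ψ t ht
    have h1 : √((s 0 ^ 2 - H) / e) = √((t 0 ^ 2 - H) / e) := add_left_cancel hst
    have h2 : (s 0 ^ 2 - H) / e = (t 0 ^ 2 - H) / e := by
      rw [← Real.sq_sqrt hs1.le, ← Real.sq_sqrt ht1.le, h1]
    have h3 : s 0 ^ 2 = t 0 ^ 2 := by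
      have := (div_left_inj' he0).1 h2
      linarith
    exact (pow_left_inj₀ hs0.le ht0.le two_ne_zero).1 h3
  · intro x hx
    obtain ⟨hxX, hxD⟩ := hdom x hx
    set u : ℝ := x 0 - X₀ with hudef
    have hu : 0 < u := sub_pos.2 hxX
    have hDv : qD e f g (x 0) = (e : ℝ) * u ^ 2 + H := by
      rw [qD_eq_vertex e f g he, ← hX₀def, ← hHdef]
    set t : ℝ := √(qD e f g (x 0)) with htdef
    have ht : 0 < t := Real.sqrt_pos.2 hxD
    have ht2 : t ^ 2 = (e : ℝ) * u ^ 2 + H := by rw [htdef, Real.sq_sqrt hxD.le, hDv]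
    have hψt : (t ^ 2 - H) / e = u ^ 2 := by rw [ht2]; field_simp; ring
    refine ⟨fun _ => t, ?_, ?_⟩
    · rw [hT₀def, hS₀def]
      refine ⟨⟨ht, ?_⟩, ?_⟩
      · rw [hψv, hψt]; positivity
      · rw [hψv, hψt]; exact hQ x hx
    · change X₀ + √((t ^ 2 - H) / e) = x 0
      rw [hψt, Real.sqrt_sq hu.le, hudef]
      ring
  · have habs : IsRatOn T₀ fun v => v 0 ^ 2 / |(e : ℝ)| :=
      ((IsRatOn.coord.pow 2).div (IsRatOn.const |e|) fun _ _ => by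
        rw [Rat.cast_abs]; exact abs_ne_zero.2 he0).congr fun v _ => by rw [Rat.cast_abs]
    exact ((hψ₀.polyAeval P).div (hψ₀.polyAeval Q) hT₀Q).mul habs
  · -- the pulled-back integrand
    have hv0 := hT₀pos v hv
    have hψpos : 0 < (v 0 ^ 2 - H) / e := by rw [← hψv]; exact hT₀ψ v hv
    have hw : 0 < √((v 0 ^ 2 - H) / e) := Real.sqrt_pos.2 hψpos
    have hwne := hw.ne'
    have hae : |(e : ℝ)| ≠ 0 := abs_ne_zero.2 he0
    have hw2 : (√((v 0 ^ 2 - H) / e)) ^ 2 = (v 0 ^ 2 - H) / e := Real.sq_sqrt hψpos.le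
    have hDw : qD e f g (X₀ + √((v 0 ^ 2 - H) / e)) = v 0 ^ 2 := by
      rw [qD_eq_vertex e f g he, ← hX₀def, ← hHdef, add_sub_cancel_left, hw2]
      field_simp
      ring
    rw [hr hvd]
    simp only [lift₁_apply]
    rw [hDw, Real.sqrt_sq hv0.le, add_sub_cancel_left, hw2, hψv, abs_div, abs_div,
      abs_of_pos (by positivity : (0 : ℝ) < 2 * v 0),
      abs_of_pos (by positivity : (0 : ℝ) < 2 * √((v 0 ^ 2 - H) / e))]
    field_simp

/-- The reflection-ready chart domain `{x > x₀, Δ > 0, Q((x − x₀)²) ≠ 0}` is `ℚ`-semialgebraic. -/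
theorem isSemialgebraic_rightQ (e f g : ℚ) (Q : Polynomial ℚ) :
    IsSemialgebraic ℚ {v : Fin 1 → ℝ | v ∈ {v : Fin 1 → ℝ | (((-f / (2 * e) : ℚ) : ℝ)) < v 0 ∧
      0 < qD e f g (v 0)} ∧ Polynomial.aeval ((v 0 - ((-f / (2 * e) : ℚ) : ℝ)) ^ 2) Q ≠ 0} := by
  have hS : IsSemialgebraic ℚ {v : Fin 1 → ℝ | (((-f / (2 * e) : ℚ) : ℝ)) < v 0 ∧
      0 < qD e f g (v 0)} := by
    convert (isSemialgebraic_setOf_eval_pos (k := ℚ) (R := ℝ)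
      (MvPolynomial.X (0 : Fin 1) - MvPolynomial.C (-f / (2 * e)) : MvPolynomial (Fin 1) ℚ)).inter
      (isSemialgebraic_setOf_eval_pos (k := ℚ) (R := ℝ)
      (MvPolynomial.C e * MvPolynomial.X (0 : Fin 1) ^ 2 + MvPolynomial.C f * MvPolynomial.X 0 +
        MvPolynomial.C g : MvPolynomial (Fin 1) ℚ)) using 1
    ext v
    simp only [mem_setOf_eq, mem_inter_iff, map_sub, map_add, map_mul, map_pow,
      MvPolynomial.aeval_X, MvPolynomial.aeval_C, eq_ratCast, sub_pos, qD]
  exact (((IsRatOn.coord.sub (IsRatOn.const (-f / (2 * e)))).pow 2).polyAeval Q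
    ).isSemialgebraic_sep_ne_zero hS

/-- **ODD-FACTOR DESCENT.** For `e ≠ 0` (any vertex value `h`) and `S = P/Q ∈ ℚ(s)` with
`Q((x − x₀)²) ≠ 0` on the domain, `[T, (x − x₀)·S((x − x₀)²)·√(e x² + f x + g)] ∈ InBaker`:
restrict to `{Δ > 0}`, split at the vertex `x₀ ∈ ℚ`, reflect the left half (the integrand changes
sign: `P ↦ −P`), and apply `InBaker.odd_right` on each half. [this node] -/
theorem InBaker.odd_factor (e f g : ℚ) (he : e ≠ 0) (P Q : Polynomial ℚ) (r : KZ.IntegralRep 1)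
    (hQ : ∀ v ∈ r.domain, Polynomial.aeval ((v 0 - ((-f / (2 * e) : ℚ) : ℝ)) ^ 2) Q ≠ 0)
    (hr : EqOn r.integrand (fun v => (v 0 - ((-f / (2 * e) : ℚ) : ℝ)) *
      (Polynomial.aeval ((v 0 - ((-f / (2 * e) : ℚ) : ℝ)) ^ 2) P /
        Polynomial.aeval ((v 0 - ((-f / (2 * e) : ℚ) : ℝ)) ^ 2) Q) * √(qD e f g (v 0))) r.domain) :
    InBaker (KZ.of r) := by
  set X₀ : ℝ := ((-f / (2 * e) : ℚ) : ℝ) with hX₀def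
  have hc : (((2 * (-f / (2 * e)) : ℚ) : ℝ)) = 2 * X₀ := by rw [hX₀def]; push_cast; ring
  refine InBaker.restrict_pos e f g r _ hr fun r₁ hsub hpos hr₁ => ?_
  refine InBaker.of_split_at (-f / (2 * e)) r₁ (fun r₂ hd₂ hi₂ => ?_) fun r₂ hd₂ hi₂ => ?_
  · -- right half
    refine InBaker.odd_right e f g he P Q r₂ (fun v hv => ?_) (fun v hv => ?_) fun v hv => ?_
    · rw [hd₂] at hv; exact ⟨hv.2, hpos v hv.1⟩
    · rw [hd₂] at hv; exact hQ v (hsub hv.1)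
    · rw [hd₂] at hv; rw [hi₂]; exact hr₁ hv.1
  · -- left half: reflect `x = 2x₀ − t`
    refine InBaker.of_reflect' (2 * (-f / (2 * e))) r₂ (isSemialgebraic_rightQ e f g Q)
      (fun x hx => ?_)
      (fun v => (v 0 - X₀) * (Polynomial.aeval ((v 0 - X₀) ^ 2) (-P) /
        Polynomial.aeval ((v 0 - X₀) ^ 2) Q) * √(qD e f g (v 0))) ?_ (fun v hv hvd => ?_)
      fun r₃ hd₃ hi₃ => ?_
    · rw [hd₂] at hx
      obtain ⟨hx₁, hxlt⟩ := hx
      have hD := hpos x hx₁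
      refine ⟨⟨?_, ?_⟩, ?_⟩
      · change X₀ < (((2 * (-f / (2 * e)) : ℚ) : ℝ)) - x 0
        rw [hc]; linarith
      · change 0 < qD e f g ((((2 * (-f / (2 * e)) : ℚ) : ℝ)) - x 0)
        rw [hc, hX₀def, qD_reflect e f g he]; exact hD
      · change Polynomial.aeval (((((2 * (-f / (2 * e)) : ℚ) : ℝ)) - x 0 - X₀) ^ 2) Q ≠ 0
        rw [hc, show (2 * X₀ - x 0 - X₀) ^ 2 = (x 0 - X₀) ^ 2 by ring]
        exact hQ x (hsub hx₁)
    · -- semialgebraic integrand on the mirror domain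
      have hS := isSemialgebraic_rightQ e f g Q
      have h1 : IsRatOn {v : Fin 1 → ℝ | v ∈ {v : Fin 1 → ℝ | (((-f / (2 * e) : ℚ) : ℝ)) < v 0 ∧
          0 < qD e f g (v 0)} ∧ Polynomial.aeval ((v 0 - ((-f / (2 * e) : ℚ) : ℝ)) ^ 2) Q ≠ 0}
          fun v => (v 0 - X₀) * (Polynomial.aeval ((v 0 - X₀) ^ 2) (-P) /
            Polynomial.aeval ((v 0 - X₀) ^ 2) Q) := by
        have hu : IsRatOn {v : Fin 1 → ℝ | v ∈ {v : Fin 1 → ℝ | (((-f / (2 * e) : ℚ) : ℝ)) < v 0 ∧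
            0 < qD e f g (v 0)} ∧ Polynomial.aeval ((v 0 - ((-f / (2 * e) : ℚ) : ℝ)) ^ 2) Q ≠ 0}
            fun v => v 0 - X₀ := IsRatOn.coord.sub (IsRatOn.const _)
        exact hu.mul (((hu.pow 2).polyAeval (-P)).div ((hu.pow 2).polyAeval Q) fun v hv => hv.2)
      exact ((h1.isSemialgebraicFunOn hS).mul_holds (IsSemialgebraicFunOn.sqrt_holds
        (isSemialgebraicFunOn_qD e f g hS))).congr fun v _ => by simp only [Pi.mul_apply]
    · -- the reflected integrand
      have hvd' : (fun _ : Fin 1 => (((2 * (-f / (2 * e)) : ℚ) : ℝ)) - v 0) ∈ r₁.domain := by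
        rw [hd₂] at hvd; exact hvd.1
      rw [hi₂, hr₁ hvd']
      simp only [hc, map_neg]
      rw [hX₀def, qD_reflect e f g he, ← hX₀def,
        show (2 * X₀ - v 0 - X₀) ^ 2 = (v 0 - X₀) ^ 2 by ring]
      ring
    · -- the reflected representation is a right half with `P ↦ −P`
      refine InBaker.odd_right e f g he (-P) Q r₃ (fun v hv => ?_) (fun v hv => ?_) fun v hv => ?_
      · rw [hd₃] at hv; exact hv.1.1
      · rw [hd₃] at hv; exact hv.1.2
      · rw [hi₃]

end Summit.KontsevichZagierPeriods.RootDecompWalshStrata.ConicDescent
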